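import Summits.QuantumFields.YangMills.Theorems.BalabanLadderNTPointwiseFloor
import Summits.QuantumFields.YangMills.Theorems.LangevinControlUVOSLegsFromFemtoAndGapStubLowerBump
import Summits.QuantumFields.YangMills.Theses.BalabanLadder
import HarnessLib

/-!
# Crux `NT` (stmt-QuantumFields-19353) — skeleton line `n32-variance`: Bałaban's N32 in NT letters as ONE named stub

Crux-plan line for `Summit.QuantumFields.YangMills.Theses.BalabanLadder.NT` (route-QuantumFields-BalabanLadder, rank 4;
LADDER-YM rung **R2a**, YM-PLAN node N29 = **N32**), director-ym R590-ym item (12), seat `ymfull-r2a-plan-1`.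
PUBLISHED with `ledger crux write … Lines/n32-variance.lean`; NOT registered by this seat (registration word = OWNER/director).

## The cut (what replaces the one-stub skeleton v4T `stub_refpkgT : RefPkgT`)

`RefPkgT` = (clauses 1–3) sign-free exterior-oscillation CEILINGS E1/E2/E3-osc on femto DLR cubes, uniform over ALL
exteriors `η, η'` + (clauses 4–5) the `Q2`/`|Q3|` floors WITH MARGIN on ONE reference torus `L₀(β)` per coupling; the
ceilings are only the device that transfers the one-torus floors to every large torus (`Reference.nt_of_torusReferencePackage`).
Bałaban's N32 ([Balaban1989LargeFieldII] p. 356, «announced, not printed»; tree carrier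
`Literature.…Balaban1983to89.T4ThermodynamicLimit.N32`, off-diagonal form `…T4SeparatedLoopFloor.N32prime`) is BY CONSTRUCTION
uniform in the volume (the `ℓ` of the torus `T_η`, constants as in (0.1) there): it is a floor on EVERY torus at once.  Typed in
NT letters that is `N32T` below — and a floor that already holds on every torus needs NO exterior-oscillation ceiling to be
transferred.  So the split of `RefPkgT`'s job is

* `stub_n32T : N32T` — **N32 in NT letters** (the ℓ-UNIFORM = all-volume two-point floor): for every compact simple `G` some
  lattice representation `r` and unit map `a > 0`, `a → 0` carry a β- AND VOLUME-UNIFORM pointwise floor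
  `ν·a(β)⁸ ≤ Cov_{T,β,L}(A_x, A_y)` on every pair of plaquette rosettes at PHYSICAL separation `a(β)‖y−x‖ ∈ [s₀, s₁]`
  (`0 < s₀ < s₁`, `ν > 0`), on every torus `2L+1` with `Λ₅ ≤ a(β)L`, for all `β ≥ β₅`.  Equivalently an `n⁻⁸` law
  `Cov ≥ (ν/s₁⁸)/n⁸` with a coefficient that does NOT vanish as `β → ∞` at lattice distances `n ≍ 1/a(β) → ∞` — the
  order-`g⁴` variance/two-point floor of N32b/N32′ for the dimension-4 density (toy `toy_twoPoint_shape` below);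
* `stub_k3T : K3T` — the THREE-POINT companion N32 does not contain (clause (ii) of `NT` is not Bałaban's): in ANY units
  carrying the N32T floor, a signed volume-uniform floor `ν₃·a(β)¹² ≤ sgn·κ₃,T(x,y,z)` (`sgn = ±1`) on the lattice triples
  charged by three disjoint physical balls;
* the rest is PROVED here (no sorry): `clauseI_of_uniformTwoPointFloor` (a non-negative Schwartz bump whose reflected cloud
  sits inside the window + the tree's `PointwiseFloor.q2Floor_of_pointwise_floor`), `clauseII_of_uniformThreePointFloor`
  (three bumps + the one-torus signed pigeonhole `sgn_mul_Q3_ge_of_pointwise_floor_at` + Riemann envelopes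
  `CeilingPrice.tendsto_envelope`), `lowerBounds_of_floors`, and the composition
  **`NT_of : N32T → K3T → Summit.QuantumFields.YangMills.Theses.BalabanLadder.NT`** (`NT_of_stubs` applies it to the stubs).

The all-exterior ceilings (clauses 1–3 of `RefPkgT`, conditionally threatened by
`Theorems/UVSeamRec/Negative/PenetrationIdentityExterior.lean: not_e1osc_of_classicalDensDeficitAtRate`) are thereby moved OFF the
`NT` leg.  The deficit half N32a has no finite physical-scale form in NT letters (the smeared one-point function of `tr F²`
diverges like `a⁻⁴/β`); its lattice-scale form `c/β ≤ ⟨1 − (1/N) Re tr U_p⟩ ≤ K/β` is already PROVED in the tree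
(`Theorems/BalabanLadderNTOnePointFloor.lean`, `…SharpPlaquetteMoments`), so the NT-currency content of N32 is the floor `N32T`.

RULE (N) (non-vacuity, one toy per hypothesis shape): `toy_twoPoint_shape` (the scale-invariant `n⁻⁸` law inhabits the
`UniformTwoPointFloor` matrix inequality with `ν = ν₀/s₁⁸`), `toy_threePoint_shape` (an `m⁻¹²` law of either sign inhabits the
`UniformThreePointFloor` inequality), `toy_window_charged` (the reflected bump cloud of the glue lies inside the window — the
hypothesis of `stub_k3T` is the conclusion shape of `stub_n32T`, same toy).  RULE (v) (junk): `0 < ν`, `0 < s₀ < s₁`, `0 < ρ`,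
`0 < ν₃`, `sgn = ±1` are conjuncts, so no stub is free at an admissible constant (with `ν = 0` / `ν₃ = 0` both would be);
neither stub is implied by `NT` (clause (i) charges ONE pair by pigeonhole, `PointwiseFloor.n8_floor_of_q2Floor`, not every pair
of an isotropic window; `K3T` quantifies over all calibrated `(r, a)`), and `K3T` alone does not give `NT` (no units), `N32T`
alone does not give clause (ii).

HONEST FRAMING.  Skeleton: two OPEN stubs (`sorry` ONLY inside `stub_n32T`, `stub_k3T`) + sorry-free glue over tree theorems;
finite-volume ∕ conditional; nothing here proves a floor; not AF, not the seam, not OS data, not the gap — the Yang–Mills mass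
gap is NOT proved; not Clay.  Cheapest falsifier of the line: a kit census of `n⁸·Cov_T(A_x,A_y)` at `n = s/a(β)` along
`β = 2.3, 2.5, 2.7` (SU(2)) in all lattice directions — a sign change inside a physical window kills `N32T` as typed (isotropy),
not clause (i).
-/

set_option autoImplicit false

noncomputable section

open scoped SchwartzMap
open MeasureTheory Filter Topology Metric
open Literature.MathematicalPhysics.QuantumFieldTheory Literature.MathematicalPhysics.QuantumLattice
open Literature.Probability.LatticeModels
open Summit.QuantumFields.YangMills.Cruxes.OSLegsFromFemtoAndGap.DlrCollarTransfer
open Summit.QuantumFields.YangMills.Theorems.OSLegsFromFemtoAndGap.StubLower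
  (exists_bump_schwartz abs_apply_le_norm timeReflection_single_zero norm_single_zero siteToE_sub)
open Summit.QuantumFields.YangMills.Cruxes.NT.Reference (tsupport_thetaTest_subset_closedBall_zero)

namespace Summit.QuantumFields.YangMills.Cruxes.NT.N32Variance

/-! ## §0 The named statements -/

section Defs

variable (G : Type) [Group G] [TopologicalSpace G] [IsTopologicalGroup G] [CompactSpace G]
  [MeasurableSpace G] [BorelSpace G] (r : LatticeRep G) (a : ℝ → ℝ)

/-- **N32 in NT letters, per `(G, r, a)` — the ℓ-UNIFORM (all-volume) two-point floor of the action density at physical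
separation.**  `∃ ν > 0`, a window `0 < s₀ < s₁`, thresholds `β₅, Λ₅`: for all `β ≥ β₅`, on EVERY torus `2L+1` with
`Λ₅ ≤ a(β)·L`, every pair of sites `x, y ∈ box L` at physical separation `a(β)‖y − x‖ ∈ [s₀, s₁]` has
`ν · a(β)⁸ ≤ Cov_{T,β,L}(A_x, A_y)` (`A_x = dens x`, the plaquette rosette at `x`).  Bałaban's N32b/N32′ (order-`g⁴`
variance / separated two-point floor of one unit-scale variable, uniform in the volume) read for the dimension-4 density:
`a⁴A_x`, `a⁴A_y` at unit-order physical separation have covariance `≥ ν`.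
[cite: Balaban1989LargeFieldII, p.356 (averaged loop variables; the deferred «loop variables» analysis, not printed)] -/
def UniformTwoPointFloor : Prop :=
  ∃ ν s₀ s₁ β₅ Λ₅ : ℝ, 0 < ν ∧ 0 < s₀ ∧ s₀ < s₁ ∧
    ∀ β : ℝ, β₅ ≤ β → ∀ L : ℕ, Λ₅ ≤ a β * L → ∀ x ∈ box 4 L, ∀ y ∈ box 4 L,
      s₀ ≤ a β * ‖siteToE (y - x)‖ → a β * ‖siteToE (y - x)‖ ≤ s₁ →
        ν * a β ^ 8 ≤ torusE G r β L (fun U => dens G r x U * dens G r y U) -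
          torusE G r β L (dens G r x) * torusE G r β L (dens G r y)

/-- **The signed three-point floor on a cloud, per `(G, r, a)`** (volume-uniform).  Three closed balls of radius `ρ > 0`
around `p₁, p₂, p₃` at pairwise centre distance `> 2ρ`, a sign `sgn = ±1`, `ν₃ > 0`, thresholds `β₅, Λ₅`: for all `β ≥ β₅`,
on every torus with `Λ₅ ≤ a(β)·L`, every lattice triple `x, y, z ∈ box L` with `a(β)x ∈ B̄(p₁,ρ)`, `a(β)y ∈ B̄(p₂,ρ)`,
`a(β)z ∈ B̄(p₃,ρ)` has `ν₃ · a(β)¹² ≤ sgn · κ₃,T(x, y, z)` (`torusK3`, the third cumulant of the rosettes). [folklore] -/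
def UniformThreePointFloor : Prop :=
  ∃ (p₁ p₂ p₃ : EuclideanSpace ℝ (Fin 4)) (ρ ν₃ sgn β₅ Λ₅ : ℝ), 0 < ρ ∧
    2 * ρ < dist p₁ p₂ ∧ 2 * ρ < dist p₂ p₃ ∧ 2 * ρ < dist p₁ p₃ ∧ 0 < ν₃ ∧ (sgn = 1 ∨ sgn = -1) ∧
    ∀ β : ℝ, β₅ ≤ β → ∀ L : ℕ, Λ₅ ≤ a β * L → ∀ x ∈ box 4 L, ∀ y ∈ box 4 L, ∀ z ∈ box 4 L,
      a β • siteToE x ∈ closedBall p₁ ρ → a β • siteToE y ∈ closedBall p₂ ρ → a β • siteToE z ∈ closedBall p₃ ρ →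
        ν₃ * a β ^ 12 ≤ sgn * torusK3 G r β L x y z

end Defs

/-- **`N32T` — Bałaban's N32 in NT letters (THE named stub statement).**  For every compact simple `G` there are a lattice
representation `r` and a unit map `a > 0`, `a → 0` carrying the volume-uniform two-point floor `UniformTwoPointFloor G r a`.
This is what FIXES the units: the floor fails if `a(β)ξ(β) → ∞` (window beyond the correlation length) and if
`a(β)ξ(β) → 0` (window in the deep UV, where `n⁸ Cov → 0` logarithmically), so it pins `a ≍ ξ⁻¹` — dimensional transmutation,
invisible to fixed-order lattice perturbation theory (`n⁸ Cov_T = O(β⁻²)` at fixed `n`).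
[cite: Balaban1989LargeFieldII, p.356 (averaged loop variables; the deferred «loop variables» analysis, not printed)] -/
def N32T : Prop :=
  ∀ (G : Type) [Group G] [TopologicalSpace G] [IsTopologicalGroup G] [CompactSpace G],
    IsCompactSimpleLieGroup G → letI : MeasurableSpace G := borel G; haveI : BorelSpace G := ⟨rfl⟩;
    ∃ (r : LatticeRep G) (a : ℝ → ℝ), (∀ β, 0 < a β) ∧ Tendsto a atTop (𝓝 0) ∧ UniformTwoPointFloor G r a

/-- **`K3T` — the three-point companion of N32 (clause (ii) of `NT` is not Bałaban's).**  In ANY units `(r, a)` carrying the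
N32T floor (`a > 0`, `a → 0`, `UniformTwoPointFloor G r a` — so `a ≍ ξ⁻¹` is already pinned), the rosettes have a signed
volume-uniform three-point floor on some cloud of three disjoint physical balls (`UniformThreePointFloor G r a`); expected
from the one-loop (or two-loop) sign of `⟨tr F²(x) tr F²(y) tr F²(z)⟩_conn` on a small (UV) triangle, where the pinned units make the
running coupling small. [folklore] -/
def K3T : Prop :=
  ∀ (G : Type) [Group G] [TopologicalSpace G] [IsTopologicalGroup G] [CompactSpace G],
    IsCompactSimpleLieGroup G → letI : MeasurableSpace G := borel G; haveI : BorelSpace G := ⟨rfl⟩;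
    ∀ (r : LatticeRep G) (a : ℝ → ℝ), (∀ β, 0 < a β) → Tendsto a atTop (𝓝 0) →
      UniformTwoPointFloor G r a → UniformThreePointFloor G r a

/-! ## §1 The stubs (the ONLY sorries of this file) -/

/-- STUB 1 (load-bearing, XL): **N32 in NT letters** — Bałaban's announced, unprinted «loop variables» analysis
([Balaban1989LargeFieldII] p. 356) read for the action density; open. -/
theorem stub_n32T : N32T := by
  sorry

/-- STUB 2 (L): the signed three-point floor in N32T-calibrated units; open (one-loop sign + a remainder bound uniform in
the volume). -/
theorem stub_k3T : K3T := by
  sorry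

/-! ## §2 Geometry of the witnesses (sorry-free glue) -/

section Geometry

/-- `‖θ u − p‖ = ‖u + p‖` for `p = t e₀`. [folklore] -/
theorem norm_timeReflection_sub_single' (u : EuclideanSpace ℝ (Fin 4)) (t : ℝ) :
    ‖timeReflection 4 u - EuclideanSpace.single 0 t‖ = ‖u + EuclideanSpace.single 0 t‖ := by
  have h : timeReflection 4 u - EuclideanSpace.single 0 t = timeReflection 4 (u + EuclideanSpace.single 0 t) := by
    rw [map_add, timeReflection_single_zero]; abel
  rw [h, LinearIsometryEquiv.norm_map]

/-- **The reflected cloud sits in a window.**  If `θu` and `w` are within `2ρ` of `p = t₀e₀` (`t₀ ≥ 0`) then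
`2t₀ − 4ρ ≤ ‖w − u‖ ≤ 2t₀ + 4ρ`. [folklore] -/
theorem window_of_near {t₀ ρ : ℝ} (ht₀ : 0 ≤ t₀) {u w : EuclideanSpace ℝ (Fin 4)}
    (hu : dist (timeReflection 4 u) (EuclideanSpace.single 0 t₀) < 2 * ρ)
    (hw : dist w (EuclideanSpace.single 0 t₀) < 2 * ρ) :
    2 * t₀ - 4 * ρ ≤ ‖w - u‖ ∧ ‖w - u‖ ≤ 2 * t₀ + 4 * ρ := by
  set p : EuclideanSpace ℝ (Fin 4) := EuclideanSpace.single 0 t₀ with hp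
  rw [dist_eq_norm, norm_timeReflection_sub_single'] at hu
  rw [dist_eq_norm] at hw
  have hpp : ‖p + p‖ = 2 * t₀ := by
    rw [← two_smul ℝ p, norm_smul, hp, norm_single_zero, Real.norm_of_nonneg (by norm_num : (0:ℝ) ≤ 2),
      abs_of_nonneg ht₀]
  have e : w - u = (w - p - (u + p)) + (p + p) := by abel
  have h1 : ‖w - p - (u + p)‖ ≤ ‖w - p‖ + ‖u + p‖ := norm_sub_le _ _
  constructor
  · have h2 : ‖p + p‖ ≤ ‖w - u‖ + ‖w - p - (u + p)‖ := by
      have : p + p = (w - u) - (w - p - (u + p)) := by rw [e]; abel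
      rw [this]; exact norm_sub_le _ _
    linarith
  · have h2 : ‖w - u‖ ≤ ‖w - p - (u + p)‖ + ‖p + p‖ := by rw [e]; exact norm_add_le _ _
    linarith

/-- Physical separation of two lattice sites at spacing `s ≥ 0`: `s‖y − x‖ = ‖s•y − s•x‖`. [folklore] -/
theorem mul_norm_siteToE_sub {s : ℝ} (hs : 0 ≤ s) (x y : Fin 4 → ℤ) :
    s * ‖siteToE (y - x)‖ = ‖s • siteToE y - s • siteToE x‖ := by
  rw [← smul_sub, ← siteToE_sub, norm_smul, Real.norm_of_nonneg hs]

/-- A closed ball around `t₀e₀` of radius `< t₀` lies in positive time. [folklore] -/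
theorem closedBall_subset_posTime {t₀ R : ℝ} (hR : R < t₀) :
    closedBall (EuclideanSpace.single 0 t₀ : EuclideanSpace ℝ (Fin 4)) R ⊆ {y : EuclideanSpace ℝ (Fin 4) | 0 < y 0} := by
  intro y hy
  rw [mem_closedBall, dist_eq_norm] at hy
  have h1 := abs_apply_le_norm (y - EuclideanSpace.single 0 t₀) 0
  have h2 : |y 0 - t₀| ≤ R := by simpa using h1.trans hy
  have h3 := (abs_le.1 h2).1
  show 0 < y 0
  linarith

/-- A bump that is `1` at its centre, non-negative and compactly supported has positive mass `‖v‖₁ > 0`. [folklore] -/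
theorem integral_abs_pos_of_bump {v : 𝓢(EuclideanSpace ℝ (Fin 4), ℝ)} (hv0 : ∀ z, 0 ≤ v z) {c : EuclideanSpace ℝ (Fin 4)}
    (hvc : v c = 1) {R : ℝ} (hvts : tsupport (v : EuclideanSpace ℝ (Fin 4) → ℝ) = closedBall c R) :
    0 < ∫ y, |v y| := by
  have e : (fun y => |v y|) = fun y => v y := funext fun y => abs_of_nonneg (hv0 y)
  rw [e]
  have hK : HasCompactSupport (v : EuclideanSpace ℝ (Fin 4) → ℝ) := by
    show IsCompact (tsupport (v : EuclideanSpace ℝ (Fin 4) → ℝ))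
    rw [hvts]; exact isCompact_closedBall _ _
  exact v.continuous.integral_pos_of_hasCompactSupport_nonneg_nonzero hK (fun z => hv0 z) (x := c) (by rw [hvc]; norm_num)

end Geometry

/-! ## §3 Clause (i) of `LowerBounds` from the N32T floor (sorry-free) -/

section ClauseOne

variable (G : Type) [Group G] [TopologicalSpace G] [IsTopologicalGroup G] [CompactSpace G]
  [MeasurableSpace G] [BorelSpace G] (r : LatticeRep G)

/-- **Clause (i) from the volume-uniform pointwise floor.**  A non-negative bump `v` at height `t₀ = (s₀+s₁)/4` with support
radius `(s₁−s₀)/8` charges only pairs inside the window `[s₀, s₁]`; there the floor `ν a⁸ ≤ Cov` holds on every large torus,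
and the tree's `PointwiseFloor.q2Floor_of_pointwise_floor` turns it into `ε ≤ Q2(θv, v)` with `ε = ν‖v‖₁²/2`. [folklore] -/
theorem clauseI_of_uniformTwoPointFloor (a : ℝ → ℝ) (ha : ∀ β, 0 < a β) (ha0 : Tendsto a atTop (𝓝 0))
    (h : UniformTwoPointFloor G r a) :
    ∃ (v : 𝓢(EuclideanSpace ℝ (Fin 4), ℝ)) (ε β₅ Λ₅ : ℝ),
      tsupport v ⊆ {y : EuclideanSpace ℝ (Fin 4) | 0 < y 0} ∧ 0 < ε ∧
        ∀ β : ℝ, β₅ ≤ β → ∀ L : ℕ, Λ₅ ≤ a β * L → ε ≤ Q2 G r β L (a β) (thetaTest 4 v) v := by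
  obtain ⟨ν, s₀, s₁, β₅, Λ₅, hν, hs₀, hs₀₁, hfl⟩ := h
  -- the bump: centre `t₀ e₀`, plateau radius `ρ`, support radius `2ρ`
  set t₀ : ℝ := (s₀ + s₁) / 4 with ht₀
  set ρ : ℝ := (s₁ - s₀) / 16 with hρ
  have hρ0 : 0 < ρ := by rw [hρ]; linarith
  have ht₀0 : 0 ≤ t₀ := by rw [ht₀]; linarith
  obtain ⟨v, hv0, -, hvone, hvsupp, hvts⟩ := exists_bump_schwartz (EuclideanSpace.single 0 t₀) hρ0
  -- positive time and a ball around the origin containing the support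
  have hpos : tsupport (v : EuclideanSpace ℝ (Fin 4) → ℝ) ⊆ {y : EuclideanSpace ℝ (Fin 4) | 0 < y 0} := by
    rw [hvts]; exact closedBall_subset_posTime (by rw [ht₀, hρ]; linarith)
  have hvσ : tsupport (v : EuclideanSpace ℝ (Fin 4) → ℝ) ⊆ closedBall 0 (2 * ρ + t₀) := by
    rw [hvts]
    refine closedBall_subset_closedBall' ?_
    rw [dist_zero_right, norm_single_zero, abs_of_nonneg ht₀0]
  have hv1 : 0 < ∫ y, |v y| :=
    integral_abs_pos_of_bump hv0 (hvone _ (by rw [dist_self]; exact hρ0.le)) hvts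
  -- the cloud floor: charged pairs lie in the window
  have hcloud : ∀ β : ℝ, β₅ ≤ β → ∀ L : ℕ, Λ₅ ≤ a β * L → ∀ x ∈ box 4 L, ∀ y ∈ box 4 L,
      thetaTest 4 v (a β • siteToE x) ≠ 0 → v (a β • siteToE y) ≠ 0 →
        ν * a β ^ 8 ≤ torusE G r β L (fun U => dens G r x U * dens G r y U) -
          torusE G r β L (dens G r x) * torusE G r β L (dens G r y) := by
    intro β hβ L hL x hx y hy hθx hvy
    rw [thetaTest_apply] at hθx
    have hu := hvsupp _ hθx
    have hw := hvsupp _ hvy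
    obtain ⟨hlo, hhi⟩ := window_of_near ht₀0 hu hw
    rw [← mul_norm_siteToE_sub (ha β).le] at hlo hhi
    refine hfl β hβ L hL x hx y hy ?_ ?_
    · refine le_trans ?_ hlo
      rw [ht₀, hρ]; linarith
    · refine hhi.trans ?_
      rw [ht₀, hρ]; linarith
  obtain ⟨ε, β₆, Λ₆, hε, hfloor⟩ :=
    PointwiseFloor.q2Floor_of_pointwise_floor G r a ha ha0 hv0 hv1 hvσ hν hcloud
  exact ⟨v, ε, β₆, Λ₆, hpos, hε, hfloor⟩

end ClauseOne

/-! ## §4 Clause (ii) of `LowerBounds` from the signed three-point floor (sorry-free) -/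

section ClauseTwo

variable (G : Type) [Group G] [TopologicalSpace G] [IsTopologicalGroup G] [CompactSpace G]
  [MeasurableSpace G] [BorelSpace G] (r : LatticeRep G)

/-- **One torus: a signed pointwise floor on the charged cloud of a non-negative triple gives a signed smeared floor.**
If `f, g, h ≥ 0` and every charged triple has `c ≤ sgn·κ₃,T(x,y,z)`, then `c · S_f S_g S_h ≤ sgn · Q3_{β,L,s}(f,g,h)`
(`S_f = Σ_{x ∈ box L} f(s x)`). [folklore] -/
theorem sgn_mul_Q3_ge_of_pointwise_floor_at (β : ℝ) (L : ℕ) (s sgn : ℝ) {f g h : 𝓢(EuclideanSpace ℝ (Fin 4), ℝ)}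
    (hf : ∀ u, 0 ≤ f u) (hg : ∀ u, 0 ≤ g u) (hh : ∀ u, 0 ≤ h u) {c : ℝ}
    (hc : ∀ x ∈ box 4 L, ∀ y ∈ box 4 L, ∀ z ∈ box 4 L,
      f (s • siteToE x) ≠ 0 → g (s • siteToE y) ≠ 0 → h (s • siteToE z) ≠ 0 → c ≤ sgn * torusK3 G r β L x y z) :
    c * ((∑ x ∈ box 4 L, f (s • siteToE x)) * (∑ y ∈ box 4 L, g (s • siteToE y)) *
      (∑ z ∈ box 4 L, h (s • siteToE z))) ≤ sgn * Q3 G r β L s f g h := by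
  have e : (∑ x ∈ box 4 L, f (s • siteToE x)) * (∑ y ∈ box 4 L, g (s • siteToE y)) *
      (∑ z ∈ box 4 L, h (s • siteToE z)) =
      ∑ x ∈ box 4 L, ∑ y ∈ box 4 L, ∑ z ∈ box 4 L, f (s • siteToE x) * g (s • siteToE y) * h (s • siteToE z) := by
    rw [Finset.sum_mul_sum, Finset.sum_mul]
    refine Finset.sum_congr rfl fun x _ => ?_
    rw [Finset.sum_mul_sum]
  rw [e, Finset.mul_sum]
  unfold Q3
  rw [Finset.mul_sum]
  refine Finset.sum_le_sum fun x hx => ?_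
  rw [Finset.mul_sum, Finset.mul_sum]
  refine Finset.sum_le_sum fun y hy => ?_
  rw [Finset.mul_sum, Finset.mul_sum]
  refine Finset.sum_le_sum fun z hz => ?_
  by_cases hfx : f (s • siteToE x) = 0
  · simp [hfx]
  by_cases hgy : g (s • siteToE y) = 0
  · simp [hgy]
  by_cases hhz : h (s • siteToE z) = 0
  · simp [hhz]
  have hw : 0 ≤ f (s • siteToE x) * g (s • siteToE y) * h (s • siteToE z) :=
    mul_nonneg (mul_nonneg (hf _) (hg _)) (hh _)
  calc c * (f (s • siteToE x) * g (s • siteToE y) * h (s • siteToE z))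
      = f (s • siteToE x) * g (s • siteToE y) * h (s • siteToE z) * c := by ring
    _ ≤ f (s • siteToE x) * g (s • siteToE y) * h (s • siteToE z) * (sgn * torusK3 G r β L x y z) :=
        mul_le_mul_of_nonneg_left (hc x hx y hy z hz hfx hgy hhz) hw
    _ = sgn * (f (s • siteToE x) * g (s • siteToE y) * h (s • siteToE z) * torusK3 G r β L x y z) := by ring

/-- **Clause (ii) from the signed volume-uniform three-point floor.**  Three non-negative bumps of support radius `ρ` around
`p₁, p₂, p₃` (pairwise disjoint supports) charge only triples of the cloud; the signed floor `ν₃ a¹² ≤ sgn·κ₃` and the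
Riemann envelopes `a⁴Σf → ‖f‖₁` give `|Q3(f,g,h)| ≥ sgn·Q3 ≥ ν₃‖f‖₁‖g‖₁‖h‖₁/2 > 0` on every large torus. [folklore] -/
theorem clauseII_of_uniformThreePointFloor (a : ℝ → ℝ) (ha : ∀ β, 0 < a β) (ha0 : Tendsto a atTop (𝓝 0))
    (h3 : UniformThreePointFloor G r a) :
    ∃ (f g h : 𝓢(EuclideanSpace ℝ (Fin 4), ℝ)) (ε β₅ Λ₅ : ℝ),
      Disjoint (tsupport f) (tsupport g) ∧ Disjoint (tsupport g) (tsupport h) ∧ Disjoint (tsupport f) (tsupport h) ∧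
        0 < ε ∧ ∀ β : ℝ, β₅ ≤ β → ∀ L : ℕ, Λ₅ ≤ a β * L → ε ≤ |Q3 G r β L (a β) f g h| := by
  obtain ⟨p₁, p₂, p₃, ρ, ν₃, sgn, β₅, Λ₅, hρ, h12, h23, h13, hν₃, hsgn, hfl⟩ := h3
  have hρ2 : 0 < ρ / 2 := by positivity
  have eρ : 2 * (ρ / 2) = ρ := by ring
  obtain ⟨f, hf0, -, hfone, hfsupp, hfts⟩ := exists_bump_schwartz p₁ hρ2
  obtain ⟨g, hg0, -, hgone, hgsupp, hgts⟩ := exists_bump_schwartz p₂ hρ2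
  obtain ⟨h, hh0, -, hhone, hhsupp, hhts⟩ := exists_bump_schwartz p₃ hρ2
  rw [eρ] at hfsupp hfts hgsupp hgts hhsupp hhts
  -- disjoint supports
  have hfg : Disjoint (tsupport (f : EuclideanSpace ℝ (Fin 4) → ℝ)) (tsupport (g : EuclideanSpace ℝ (Fin 4) → ℝ)) := by
    rw [hfts, hgts]; exact closedBall_disjoint_closedBall (by linarith)
  have hgh : Disjoint (tsupport (g : EuclideanSpace ℝ (Fin 4) → ℝ)) (tsupport (h : EuclideanSpace ℝ (Fin 4) → ℝ)) := by
    rw [hgts, hhts]; exact closedBall_disjoint_closedBall (by linarith)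
  have hfh : Disjoint (tsupport (f : EuclideanSpace ℝ (Fin 4) → ℝ)) (tsupport (h : EuclideanSpace ℝ (Fin 4) → ℝ)) := by
    rw [hfts, hhts]; exact closedBall_disjoint_closedBall (by linarith)
  -- one ball around the origin containing the three supports
  set σ : ℝ := ‖p₁‖ + ‖p₂‖ + ‖p₃‖ + ρ with hσ
  have hfσ : tsupport (f : EuclideanSpace ℝ (Fin 4) → ℝ) ⊆ closedBall 0 σ := by
    rw [hfts]; refine closedBall_subset_closedBall' ?_
    rw [dist_zero_right, hσ]; linarith [norm_nonneg p₂, norm_nonneg p₃]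
  have hgσ : tsupport (g : EuclideanSpace ℝ (Fin 4) → ℝ) ⊆ closedBall 0 σ := by
    rw [hgts]; refine closedBall_subset_closedBall' ?_
    rw [dist_zero_right, hσ]; linarith [norm_nonneg p₁, norm_nonneg p₃]
  have hhσ : tsupport (h : EuclideanSpace ℝ (Fin 4) → ℝ) ⊆ closedBall 0 σ := by
    rw [hhts]; refine closedBall_subset_closedBall' ?_
    rw [dist_zero_right, hσ]; linarith [norm_nonneg p₁, norm_nonneg p₂]
  -- positive masses
  have hf1 : 0 < ∫ y, |f y| := integral_abs_pos_of_bump hf0 (hfone _ (by rw [dist_self]; exact hρ2.le)) hfts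
  have hg1 : 0 < ∫ y, |g y| := integral_abs_pos_of_bump hg0 (hgone _ (by rw [dist_self]; exact hρ2.le)) hgts
  have hh1 : 0 < ∫ y, |h y| := integral_abs_pos_of_bump hh0 (hhone _ (by rw [dist_self]; exact hρ2.le)) hhts
  -- reference boxes covering the supports and the Riemann envelopes
  set L₁ : ℝ → ℕ := fun β => ⌈σ / a β⌉₊ with hL₁
  have hL₁σ : ∀ β, σ ≤ a β * L₁ β := fun β => by
    have h1 : σ / a β ≤ L₁ β := Nat.le_ceil _
    calc σ = a β * (σ / a β) := by field_simp [(ha β).ne']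
      _ ≤ a β * L₁ β := mul_le_mul_of_nonneg_left h1 (ha β).le
  have hcov : ∀ β (L : ℕ), σ ≤ a β * L → L₁ β ≤ L := fun β L hL => by
    refine Nat.ceil_le.2 ?_
    rw [div_le_iff₀ (ha β), mul_comm]
    exact hL
  have hlim := ((CeilingPrice.tendsto_envelope f hfσ a L₁ ha ha0 (Eventually.of_forall hL₁σ)).mul
    (CeilingPrice.tendsto_envelope g hgσ a L₁ ha ha0 (Eventually.of_forall hL₁σ))).mul
    (CeilingPrice.tendsto_envelope h hhσ a L₁ ha ha0 (Eventually.of_forall hL₁σ))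
  have hP : 0 < (∫ y, |f y|) * (∫ y, |g y|) * (∫ y, |h y|) := mul_pos (mul_pos hf1 hg1) hh1
  have hhalf : (∫ y, |f y|) * (∫ y, |g y|) * (∫ y, |h y|) / 2 < (∫ y, |f y|) * (∫ y, |g y|) * (∫ y, |h y|) := by
    linarith
  obtain ⟨β₆, hβ₆⟩ := ((hlim.eventually (lt_mem_nhds hhalf)).and (eventually_ge_atTop β₅)).exists_forall_of_atTop
  refine ⟨f, g, h, ν₃ * ((∫ y, |f y|) * (∫ y, |g y|) * (∫ y, |h y|) / 2), β₆, max Λ₅ σ, hfg, hgh, hfh, by positivity,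
    fun β hβ L hL => ?_⟩
  obtain ⟨hPβ, hβ5⟩ := hβ₆ β hβ
  have hΛ : Λ₅ ≤ a β * L := (le_max_left _ _).trans hL
  have hσL : σ ≤ a β * L := (le_max_right _ _).trans hL
  -- the signed one-torus floor on the charged cloud
  have hq := sgn_mul_Q3_ge_of_pointwise_floor_at G r β L (a β) sgn hf0 hg0 hh0 (c := ν₃ * a β ^ 12)
    (fun x hx y hy z hz hfx hgy hhz => hfl β hβ5 L hΛ x hx y hy z hz
      (mem_closedBall.2 (hfsupp _ hfx).le) (mem_closedBall.2 (hgsupp _ hgy).le) (mem_closedBall.2 (hhsupp _ hhz).le))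
  -- envelope sums: drop the absolute values, move to the reference box
  have hfabs : ∑ x ∈ box 4 L, f (a β • siteToE x) = ∑ x ∈ box 4 L, |f (a β • siteToE x)| :=
    Finset.sum_congr rfl fun x _ => (abs_of_nonneg (hf0 _)).symm
  have hgabs : ∑ y ∈ box 4 L, g (a β • siteToE y) = ∑ y ∈ box 4 L, |g (a β • siteToE y)| :=
    Finset.sum_congr rfl fun y _ => (abs_of_nonneg (hg0 _)).symm
  have hhabs : ∑ z ∈ box 4 L, h (a β • siteToE z) = ∑ z ∈ box 4 L, |h (a β • siteToE z)| :=
    Finset.sum_congr rfl fun z _ => (abs_of_nonneg (hh0 _)).symm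
  have hfeq := CeilingPrice.sum_box_eq_sum_box_of_cover (φ := fun u => |f u|) (ha β)
    (CeilingPrice.tsupport_abs_subset hfσ) (hL₁σ β) (hcov β L hσL)
  have hgeq := CeilingPrice.sum_box_eq_sum_box_of_cover (φ := fun u => |g u|) (ha β)
    (CeilingPrice.tsupport_abs_subset hgσ) (hL₁σ β) (hcov β L hσL)
  have hheq := CeilingPrice.sum_box_eq_sum_box_of_cover (φ := fun u => |h u|) (ha β)
    (CeilingPrice.tsupport_abs_subset hhσ) (hL₁σ β) (hcov β L hσL)
  rw [hfabs, hgabs, hhabs, hfeq, hgeq, hheq] at hq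
  have e : ν₃ * a β ^ 12 * ((∑ x ∈ box 4 (L₁ β), |f (a β • siteToE x)|) *
      (∑ y ∈ box 4 (L₁ β), |g (a β • siteToE y)|) * (∑ z ∈ box 4 (L₁ β), |h (a β • siteToE z)|)) =
      ν₃ * ((a β ^ 4 * ∑ x ∈ box 4 (L₁ β), |f (a β • siteToE x)|) *
        (a β ^ 4 * ∑ y ∈ box 4 (L₁ β), |g (a β • siteToE y)|) * (a β ^ 4 * ∑ z ∈ box 4 (L₁ β), |h (a β • siteToE z)|)) := by
    ring
  rw [e] at hq
  have habs : sgn * Q3 G r β L (a β) f g h ≤ |Q3 G r β L (a β) f g h| := by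
    rcases hsgn with h1 | h1 <;> rw [h1]
    · rw [one_mul]; exact le_abs_self _
    · rw [neg_one_mul]; exact neg_le_abs _
  refine le_trans ?_ (hq.trans habs)
  have := mul_le_mul_of_nonneg_left hPβ.le hν₃.le
  linarith

end ClauseTwo

/-! ## §5 The composition: the stubs give the crux BY NAME (sorry-free) -/

section Compose

variable (G : Type) [Group G] [TopologicalSpace G] [IsTopologicalGroup G] [CompactSpace G]
  [MeasurableSpace G] [BorelSpace G] (r : LatticeRep G)

/-- `LowerBounds G r a` from the two volume-uniform floors in the same units. [folklore] -/
theorem lowerBounds_of_floors (a : ℝ → ℝ) (ha : ∀ β, 0 < a β) (ha0 : Tendsto a atTop (𝓝 0))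
    (h2 : UniformTwoPointFloor G r a) (h3 : UniformThreePointFloor G r a) : LowerBounds G r a :=
  ⟨clauseI_of_uniformTwoPointFloor G r a ha ha0 h2, clauseII_of_uniformThreePointFloor G r a ha ha0 h3⟩

end Compose

/-- **THE COMPOSITION `NT_of : N32T → K3T → NT`** — the two stubs give the crux `BalabanLadder.NT` BY NAME; no smuggled
input (the glue of §§2–4 is proved above over tree theorems). -/
theorem NT_of (h1 : N32T) (h2 : K3T) : Summit.QuantumFields.YangMills.Theses.BalabanLadder.NT := by
  intro G _ _ _ _ hG
  letI : MeasurableSpace G := borel G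
  haveI : BorelSpace G := ⟨rfl⟩
  obtain ⟨r, a, ha, ha0, hfl2⟩ := h1 G hG
  have hfl3 := h2 G hG r a ha ha0 hfl2
  exact ⟨r, a, ha, ha0, lowerBounds_of_floors G r a ha ha0 hfl2 hfl3⟩

/-- The crux from the stubs (skeleton-of-record shape: `NT` follows from `stub_n32T`, `stub_k3T`). -/
theorem NT_of_stubs : Summit.QuantumFields.YangMills.Theses.BalabanLadder.NT :=
  NT_of stub_n32T stub_k3T

/-! ## §6 Rule (N) toys — every hypothesis shape is inhabited by a non-junk model (sorry-free `example`s) -/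

section Toys

/-- TOY (N32T shape).  The scale-invariant `n⁻⁸` law with a β-uniform amplitude `ν₀ > 0` — the expected one-loop shape of
`Cov_T(A_x, A_y)`, `n = ‖y − x‖` — inhabits the `UniformTwoPointFloor` inequality on the window `a·n ≤ s₁` with
`ν = ν₀/s₁⁸`: `(ν₀/s₁⁸)·a⁸ ≤ ν₀/n⁸`. -/
theorem toy_twoPoint_shape {ν₀ s₁ a n : ℝ} (hν₀ : 0 < ν₀) (ha : 0 < a) (hn : 0 < n) (h : a * n ≤ s₁) :
    ν₀ / s₁ ^ 8 * a ^ 8 ≤ ν₀ / n ^ 8 := by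
  have hs₁ : 0 < s₁ := lt_of_lt_of_le (mul_pos ha hn) h
  have key : a ^ 8 / s₁ ^ 8 ≤ 1 / n ^ 8 := by
    rw [div_le_div_iff₀ (by positivity) (by positivity), one_mul]
    calc a ^ 8 * n ^ 8 = (a * n) ^ 8 := by ring
      _ ≤ s₁ ^ 8 := by gcongr
  calc ν₀ / s₁ ^ 8 * a ^ 8 = ν₀ * (a ^ 8 / s₁ ^ 8) := by ring
    _ ≤ ν₀ * (1 / n ^ 8) := mul_le_mul_of_nonneg_left key hν₀.le
    _ = ν₀ / n ^ 8 := by ring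

/-- TOY (K3T conclusion shape).  An `m⁻¹²` law of either sign `sgn = ±1` with amplitude `κ₀ > 0`, `κ₃ = sgn·κ₀/m¹²`
(`m` = largest pairwise lattice separation of the triple, `a·m ≤ D` on the cloud), inhabits the `UniformThreePointFloor`
inequality with `ν₃ = κ₀/D¹²`: `(κ₀/D¹²)·a¹² ≤ sgn·(sgn·κ₀/m¹²)`. -/
theorem toy_threePoint_shape {κ₀ D a m sgn : ℝ} (hκ₀ : 0 < κ₀) (ha : 0 < a) (hm : 0 < m) (h : a * m ≤ D)
    (hsgn : sgn = 1 ∨ sgn = -1) : κ₀ / D ^ 12 * a ^ 12 ≤ sgn * (sgn * κ₀ / m ^ 12) := by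
  have hD : 0 < D := lt_of_lt_of_le (mul_pos ha hm) h
  have hss : sgn * sgn = 1 := by rcases hsgn with h1 | h1 <;> rw [h1] <;> norm_num
  have e : sgn * (sgn * κ₀ / m ^ 12) = κ₀ / m ^ 12 := by
    rw [show sgn * (sgn * κ₀ / m ^ 12) = sgn * sgn * κ₀ / m ^ 12 by ring, hss, one_mul]
  rw [e]
  have key : a ^ 12 / D ^ 12 ≤ 1 / m ^ 12 := by
    rw [div_le_div_iff₀ (by positivity) (by positivity), one_mul]
    calc a ^ 12 * m ^ 12 = (a * m) ^ 12 := by ring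
      _ ≤ D ^ 12 := by gcongr
  calc κ₀ / D ^ 12 * a ^ 12 = κ₀ * (a ^ 12 / D ^ 12) := by ring
    _ ≤ κ₀ * (1 / m ^ 12) := mul_le_mul_of_nonneg_left key hκ₀.le
    _ = κ₀ / m ^ 12 := by ring

/-- TOY (the glue's use of the window; also the hypothesis shape of `stub_k3T`).  The reflected bump cloud of
`clauseI_of_uniformTwoPointFloor` — centre `t₀ = (s₀+s₁)/4`, support radius `2ρ = (s₁−s₀)/8` — lies inside the window:
`s₀ ≤ 2t₀ − 4ρ` and `2t₀ + 4ρ ≤ s₁`, and it sits in positive time `2ρ < t₀` as soon as `0 < s₀ < s₁`. -/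
theorem toy_window_charged {s₀ s₁ : ℝ} (hs₀ : 0 < s₀) (hs : s₀ < s₁) :
    s₀ ≤ 2 * ((s₀ + s₁) / 4) - 4 * ((s₁ - s₀) / 16) ∧ 2 * ((s₀ + s₁) / 4) + 4 * ((s₁ - s₀) / 16) ≤ s₁ ∧
      2 * ((s₁ - s₀) / 16) < (s₀ + s₁) / 4 := by
  refine ⟨by linarith, by linarith, by linarith⟩

end Toys

end Summit.QuantumFields.YangMills.Cruxes.NT.N32Variance

end
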